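import Literature.Analysis.Pluripotential.WeightedLogPolynomialLevelSets
import HarnessLib

/-!
# Comparison and invariance properties of Lelong numbers

Topic `Literature/Analysis/Pluripotential`. General facts about the slope ("Kiselman") Lelong
number `ν(u, a) = sup {γ ≥ 0 | u ≤ γ log ‖z - a‖ + O(1) near a}` of a function
`u : E → [-∞, +∞]` (`Plurisubharmonic.lean`), valid in any normed space and needed whenever Lelong
numbers are moved between charts, restricted to submanifolds or compared:

* `lelongSlopes_subset_of_eventually_le`, `lelongNumber_le_of_eventually_le` — monotonicity:
  `u ≤ v` near `a` gives `ν(v, a) ≤ ν(u, a)`;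
* `lelongSlopes_subset_lelongSlopes_comp` — **pull-back along a map Lipschitz at the point**:
  if `Φ z → Φ a` with `Φ z ≠ Φ a` for `z ≠ a` near `a` and `‖Φ z - Φ a‖ ≤ K ‖z - a‖` near `a`,
  every admissible slope of `u` at `Φ a` is an admissible slope of `u ∘ Φ` at `a`; hence
  `ν(u ∘ Φ, a) ≥ ν(u, Φ a)` (`lelongNumber_comp_ge`) — in particular **restriction to an affine
  subspace (or any isometrically embedded space) can only increase Lelong numbers**
  (`lelongNumber_comp_isometry_ge`), and differentiable maps qualify
  (`lelongSlopes_subset_lelongSlopes_comp_of_differentiableAt`);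
* `lelongSlopes_comp_eq_of_openPartialHomeomorph`, `lelongNumber_comp_eq_of_openPartialHomeomorph` —
  **invariance under local bi-Lipschitz-at-the-point homeomorphisms**, e.g. biholomorphic changes
  of coordinates (both `Φ` and `Φ⁻¹` differentiable at the base points): `ν(u ∘ Φ, a) = ν(u, Φ a)`;
* `lelongNumber_add_ge` — **superadditivity** `ν(u + v, a) ≥ ν(u, a) + ν(v, a)`.

## References

* [HormanderSCV1973] L. Hörmander, An introduction to complex analysis in several variables
  (1973), §2.6; L. Hörmander, Notions of Convexity (1994), §4.1 (Lelong numbers as slopes).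
* [Siu1974] Y.-T. Siu, Invent. Math. 27 (1974) — invariance of Lelong numbers under coordinate
  changes (here in the elementary slope form).
* [DangDoPham2025, §2.1] for the slope definition used in this tree.
-/

noncomputable section

open scoped Topology ENNReal
open Filter Set Metric

namespace Literature.Analysis.Pluripotential

variable {E F : Type*} [NormedAddCommGroup E] [NormedAddCommGroup F]

/-! ### Monotonicity in the function -/

/-- If `u ≤ v` near `a` (punctured), every admissible slope of `v` is admissible for `u`.
[folklore] -/
theorem lelongSlopes_subset_of_eventually_le {u v : E → EReal} {a : E}
    (h : ∀ᶠ z in 𝓝[≠] a, u z ≤ v z) : lelongSlopes v a ⊆ lelongSlopes u a := by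
  rintro γ ⟨hγ0, C, hC⟩
  exact ⟨hγ0, C, (h.and hC).mono fun z hz ↦ hz.1.trans hz.2⟩

/-- **Monotonicity of Lelong numbers**: `u ≤ v` near `a` gives `ν(v, a) ≤ ν(u, a)`, provided the
slopes of `u` are bounded above (true for `u` psh `≢ -∞` near `a`) and `v` is bounded above near
`a` (so that `0` is an admissible slope of `v`). [folklore] -/
theorem lelongNumber_le_of_eventually_le {u v : E → EReal} {a : E}
    (h : ∀ᶠ z in 𝓝[≠] a, u z ≤ v z) (hbdd : BddAbove (lelongSlopes u a))
    {C : ℝ} (hv : ∀ᶠ z in 𝓝[≠] a, v z ≤ (C : EReal)) :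
    lelongNumber v a ≤ lelongNumber u a := by
  rw [lelongNumber_eq_sSup, lelongNumber_eq_sSup]
  exact csSup_le_csSup hbdd ⟨0, zero_mem_lelongSlopes hv⟩ (lelongSlopes_subset_of_eventually_le h)

/-! ### Pull-back along maps Lipschitz at the base point -/

/-- **Pull-back of admissible slopes**: let `Φ : E → F` satisfy, at the point `a`,
(i) `Φ z → Φ a` and `Φ z ≠ Φ a` as `z → a`, `z ≠ a` (i.e. `Φ` maps the punctured neighbourhood
filter of `a` into that of `Φ a`), and (ii) `‖Φ z - Φ a‖ ≤ K ‖z - a‖` near `a`. Then every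
admissible slope of `u` at `Φ a` is an admissible slope of `u ∘ Φ` at `a`. [folklore] -/
theorem lelongSlopes_subset_lelongSlopes_comp {Φ : E → F} {a : E} {u : F → EReal}
    (hΦ : Tendsto Φ (𝓝[≠] a) (𝓝[≠] (Φ a))) {K : ℝ} (hK : 0 < K)
    (hlip : ∀ᶠ z in 𝓝 a, ‖Φ z - Φ a‖ ≤ K * ‖z - a‖) :
    lelongSlopes u (Φ a) ⊆ lelongSlopes (u ∘ Φ) a := by
  rintro γ ⟨hγ0, C, hC⟩
  refine ⟨hγ0, γ * Real.log K + C, ?_⟩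
  have h1 : ∀ᶠ z in 𝓝[≠] a, u (Φ z) ≤ ((γ * Real.log ‖Φ z - Φ a‖ + C : ℝ) : EReal) :=
    hΦ.eventually hC
  have h2 : ∀ᶠ z in 𝓝[≠] a, Φ z ≠ Φ a := hΦ.eventually self_mem_nhdsWithin
  filter_upwards [h1, h2, mem_nhdsWithin_of_mem_nhds hlip, self_mem_nhdsWithin] with z hz hzΦ hzl hza
  refine hz.trans (EReal.coe_le_coe_iff.2 ?_)
  have hpos : 0 < ‖Φ z - Φ a‖ := norm_pos_iff.2 (sub_ne_zero.2 hzΦ)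
  have hza' : 0 < ‖z - a‖ := norm_pos_iff.2 (sub_ne_zero.2 hza)
  have hlog : Real.log ‖Φ z - Φ a‖ ≤ Real.log K + Real.log ‖z - a‖ := by
    rw [← Real.log_mul hK.ne' hza'.ne']
    exact Real.log_le_log hpos hzl
  nlinarith [mul_le_mul_of_nonneg_left hlog hγ0]

/-- **Restriction / pull-back can only increase Lelong numbers**: under the hypotheses of
`lelongSlopes_subset_lelongSlopes_comp`, `ν(u ∘ Φ, a) ≥ ν(u, Φ a)` as soon as the slopes of
`u ∘ Φ` at `a` are bounded above and `u` is bounded above near `Φ a`. [folklore] -/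
theorem lelongNumber_comp_ge {Φ : E → F} {a : E} {u : F → EReal}
    (hΦ : Tendsto Φ (𝓝[≠] a) (𝓝[≠] (Φ a))) {K : ℝ} (hK : 0 < K)
    (hlip : ∀ᶠ z in 𝓝 a, ‖Φ z - Φ a‖ ≤ K * ‖z - a‖) (hbdd : BddAbove (lelongSlopes (u ∘ Φ) a))
    {C : ℝ} (hu : ∀ᶠ y in 𝓝[≠] (Φ a), u y ≤ (C : EReal)) :
    lelongNumber u (Φ a) ≤ lelongNumber (u ∘ Φ) a := by
  rw [lelongNumber_eq_sSup, lelongNumber_eq_sSup]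
  exact csSup_le_csSup hbdd ⟨0, zero_mem_lelongSlopes hu⟩
    (lelongSlopes_subset_lelongSlopes_comp hΦ hK hlip)

/-- An isometric map (e.g. the inclusion of an affine subspace, `w ↦ z₀ + ι w` with `ι` a linear
isometry) satisfies the hypotheses of `lelongSlopes_subset_lelongSlopes_comp` with `K = 1`:
**restriction to an isometrically embedded subspace can only increase Lelong numbers** (at the
level of admissible slopes). [folklore] -/
theorem lelongSlopes_subset_lelongSlopes_comp_isometry {Φ : E → F} (hΦ : Isometry Φ) (a : E)
    (u : F → EReal) : lelongSlopes u (Φ a) ⊆ lelongSlopes (u ∘ Φ) a := by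
  refine lelongSlopes_subset_lelongSlopes_comp ?_ one_pos (Eventually.of_forall fun z ↦ ?_)
  · refine tendsto_nhdsWithin_of_tendsto_nhds_of_eventually_within _
      (hΦ.continuous.continuousAt.mono_left nhdsWithin_le_nhds) ?_
    filter_upwards [self_mem_nhdsWithin] with z hz
    exact fun h ↦ hz (hΦ.injective h)
  · rw [one_mul, ← dist_eq_norm, ← dist_eq_norm, hΦ.dist_eq]

/-- `ν(u ∘ Φ, a) ≥ ν(u, Φ a)` for an isometric map `Φ`. [folklore] -/
theorem lelongNumber_comp_isometry_ge {Φ : E → F} (hΦ : Isometry Φ) (a : E) {u : F → EReal}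
    (hbdd : BddAbove (lelongSlopes (u ∘ Φ) a)) {C : ℝ}
    (hu : ∀ᶠ y in 𝓝[≠] (Φ a), u y ≤ (C : EReal)) :
    lelongNumber u (Φ a) ≤ lelongNumber (u ∘ Φ) a := by
  rw [lelongNumber_eq_sSup, lelongNumber_eq_sSup]
  exact csSup_le_csSup hbdd ⟨0, zero_mem_lelongSlopes hu⟩
    (lelongSlopes_subset_lelongSlopes_comp_isometry hΦ a u)

/-- A map differentiable at `a` (over `ℝ` or `ℂ`) is Lipschitz at the point `a`:
`‖Φ z - Φ a‖ ≤ K ‖z - a‖` near `a` for some `K > 0`. [folklore] -/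
theorem exists_eventually_norm_sub_le_of_differentiableAt {𝕜 : Type*} [NontriviallyNormedField 𝕜]
    [NormedSpace 𝕜 E] [NormedSpace 𝕜 F] {Φ : E → F} {a : E} (hΦ : DifferentiableAt 𝕜 Φ a) :
    ∃ K : ℝ, 0 < K ∧ ∀ᶠ z in 𝓝 a, ‖Φ z - Φ a‖ ≤ K * ‖z - a‖ := by
  have hO := hΦ.isBigO_sub
  obtain ⟨K, hK0, hK⟩ := hO.exists_pos
  rw [Asymptotics.IsBigOWith] at hK
  exact ⟨K, hK0, hK⟩

/-- Pull-back of admissible slopes along a map differentiable at `a` which maps punctured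
neighbourhoods of `a` into punctured neighbourhoods of `Φ a` (e.g. a local homeomorphism).
[folklore] -/
theorem lelongSlopes_subset_lelongSlopes_comp_of_differentiableAt {𝕜 : Type*}
    [NontriviallyNormedField 𝕜] [NormedSpace 𝕜 E] [NormedSpace 𝕜 F] {Φ : E → F} {a : E}
    (hΦ : DifferentiableAt 𝕜 Φ a) (hΦ' : Tendsto Φ (𝓝[≠] a) (𝓝[≠] (Φ a))) (u : F → EReal) :
    lelongSlopes u (Φ a) ⊆ lelongSlopes (u ∘ Φ) a := by
  obtain ⟨K, hK, hlip⟩ := exists_eventually_norm_sub_le_of_differentiableAt hΦ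
  exact lelongSlopes_subset_lelongSlopes_comp hΦ' hK hlip

/-! ### Invariance under local homeomorphisms bi-Lipschitz at the point -/

/-- A partial homeomorphism maps punctured neighbourhoods of a point of its source into punctured
neighbourhoods of the image. [folklore] -/
theorem OpenPartialHomeomorph.tendsto_nhdsWithin_compl {X Y : Type*} [TopologicalSpace X]
    [TopologicalSpace Y] (Φ : OpenPartialHomeomorph X Y) {a : X} (ha : a ∈ Φ.source) :
    Tendsto Φ (𝓝[≠] a) (𝓝[≠] (Φ a)) := by
  refine tendsto_nhdsWithin_of_tendsto_nhds_of_eventually_within _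
    ((Φ.continuousAt ha).mono_left nhdsWithin_le_nhds) ?_
  have hsrc : ∀ᶠ z in 𝓝[≠] a, z ∈ Φ.source :=
    mem_nhdsWithin_of_mem_nhds (Φ.open_source.mem_nhds ha)
  filter_upwards [hsrc, self_mem_nhdsWithin] with z hz hza
  exact fun h ↦ hza (Φ.injOn hz ha h)

/-- **Invariance of admissible slopes under a local homeomorphism which, together with its
inverse, is Lipschitz at the base point** (e.g. a biholomorphic or `C¹`-diffeomorphic change of
coordinates). [folklore] -/
theorem lelongSlopes_comp_eq_of_openPartialHomeomorph (Φ : OpenPartialHomeomorph E F) {a : E}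
    (ha : a ∈ Φ.source) {K : ℝ} (hK : 0 < K)
    (hlip : ∀ᶠ z in 𝓝 a, ‖Φ z - Φ a‖ ≤ K * ‖z - a‖)
    (hlip' : ∀ᶠ y in 𝓝 (Φ a), ‖Φ.symm y - Φ.symm (Φ a)‖ ≤ K * ‖y - Φ a‖) (u : F → EReal) :
    lelongSlopes (u ∘ Φ) a = lelongSlopes u (Φ a) := by
  refine Subset.antisymm ?_ (lelongSlopes_subset_lelongSlopes_comp
    (OpenPartialHomeomorph.tendsto_nhdsWithin_compl Φ ha) hK hlip)
  -- apply the pull-back lemma to `Φ.symm` at `Φ a`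
  have ha' : Φ a ∈ Φ.symm.source := Φ.map_source ha
  have hsymm : Φ.symm (Φ a) = a := Φ.left_inv ha
  have h := lelongSlopes_subset_lelongSlopes_comp (u := u ∘ Φ)
    (OpenPartialHomeomorph.tendsto_nhdsWithin_compl Φ.symm ha') hK hlip'
  rw [hsymm] at h
  refine h.trans (lelongSlopes_subset_of_eventually_le ?_)
  -- `u ∘ Φ ∘ Φ.symm = u` near `Φ a`
  have htgt : ∀ᶠ y in 𝓝[≠] (Φ a), y ∈ Φ.target :=
    mem_nhdsWithin_of_mem_nhds (Φ.open_target.mem_nhds (Φ.map_source ha))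
  filter_upwards [htgt] with y hy
  simp only [Function.comp_apply, Φ.right_inv hy, le_refl]

/-- **Invariance of Lelong numbers under local bi-Lipschitz-at-the-point homeomorphisms**, in
particular under biholomorphic changes of coordinates: `ν(u ∘ Φ, a) = ν(u, Φ a)`.
[cite: Siu1974, §1 (independence of Lelong numbers of the coordinates), slope form; folklore] -/
theorem lelongNumber_comp_eq_of_openPartialHomeomorph (Φ : OpenPartialHomeomorph E F) {a : E}
    (ha : a ∈ Φ.source) {K : ℝ} (hK : 0 < K)
    (hlip : ∀ᶠ z in 𝓝 a, ‖Φ z - Φ a‖ ≤ K * ‖z - a‖)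
    (hlip' : ∀ᶠ y in 𝓝 (Φ a), ‖Φ.symm y - Φ.symm (Φ a)‖ ≤ K * ‖y - Φ a‖) (u : F → EReal) :
    lelongNumber (u ∘ Φ) a = lelongNumber u (Φ a) := by
  rw [lelongNumber_eq_sSup, lelongNumber_eq_sSup,
    lelongSlopes_comp_eq_of_openPartialHomeomorph Φ ha hK hlip hlip' u]

/-- The differentiable case: if `Φ` is differentiable at `a` and `Φ.symm` at `Φ a` (over `ℝ` or
`ℂ`; e.g. `Φ` a local diffeomorphism or biholomorphism), then `ν(u ∘ Φ, a) = ν(u, Φ a)`.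
[folklore] -/
theorem lelongNumber_comp_eq_of_differentiableAt {𝕜 : Type*} [NontriviallyNormedField 𝕜]
    [NormedSpace 𝕜 E] [NormedSpace 𝕜 F] (Φ : OpenPartialHomeomorph E F) {a : E} (ha : a ∈ Φ.source)
    (hΦ : DifferentiableAt 𝕜 Φ a) (hΦ' : DifferentiableAt 𝕜 Φ.symm (Φ a)) (u : F → EReal) :
    lelongNumber (u ∘ Φ) a = lelongNumber u (Φ a) := by
  obtain ⟨K₁, hK₁, h₁⟩ := exists_eventually_norm_sub_le_of_differentiableAt hΦ
  obtain ⟨K₂, hK₂, h₂⟩ := exists_eventually_norm_sub_le_of_differentiableAt hΦ'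
  refine lelongNumber_comp_eq_of_openPartialHomeomorph Φ ha (K := max K₁ K₂) (lt_max_of_lt_left hK₁)
    (h₁.mono fun z hz ↦ hz.trans ?_) (h₂.mono fun y hy ↦ hy.trans ?_) u
  · exact mul_le_mul_of_nonneg_right (le_max_left _ _) (norm_nonneg _)
  · exact mul_le_mul_of_nonneg_right (le_max_right _ _) (norm_nonneg _)

/-! ### Superadditivity -/

/-- **Superadditivity of Lelong numbers**: `ν(u + v, a) ≥ ν(u, a) + ν(v, a)`, provided the slopes
of `u + v` at `a` are bounded above and `u`, `v` are bounded above near `a`. [folklore] -/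
theorem lelongNumber_add_ge {u v : E → EReal} {a : E} (hbdd : BddAbove (lelongSlopes (u + v) a))
    {C : ℝ} (hu : ∀ᶠ z in 𝓝[≠] a, u z ≤ (C : EReal)) {C' : ℝ}
    (hv : ∀ᶠ z in 𝓝[≠] a, v z ≤ (C' : EReal)) :
    lelongNumber u a + lelongNumber v a ≤ lelongNumber (u + v) a := by
  -- every `γ < ν(u)`, `γ' < ν(v)` give the admissible slope `γ + γ'` of `u + v`
  have h0u := zero_mem_lelongSlopes hu
  have h0v := zero_mem_lelongSlopes hv
  by_contra hlt
  push Not at hlt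
  -- choose `γ ≤ ν(u)`, `γ' ≤ ν(v)` admissible with `γ + γ' > ν(u + v)`
  set ε : ℝ := (lelongNumber u a + lelongNumber v a - lelongNumber (u + v) a) / 2 with hε
  have hε0 : 0 < ε := by rw [hε]; linarith
  -- admissible slopes close to the Lelong numbers
  have hγ : ∃ γ ∈ lelongSlopes u a, lelongNumber u a - ε < γ := by
    rcases eq_or_lt_of_le (lelongNumber_nonneg u a) with h0 | hpos
    · exact ⟨0, h0u, by rw [← h0]; linarith⟩
    · have hlt' : max 0 (lelongNumber u a - ε / 2) < lelongNumber u a :=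
        max_lt hpos (by linarith)
      exact ⟨_, mem_lelongSlopes_of_lt_lelongNumber (le_max_left _ _) hlt',
        lt_of_lt_of_le (by linarith) (le_max_right _ _)⟩
  have hγ' : ∃ γ' ∈ lelongSlopes v a, lelongNumber v a - ε < γ' := by
    rcases eq_or_lt_of_le (lelongNumber_nonneg v a) with h0 | hpos
    · exact ⟨0, h0v, by rw [← h0]; linarith⟩
    · have hlt' : max 0 (lelongNumber v a - ε / 2) < lelongNumber v a :=
        max_lt hpos (by linarith)
      exact ⟨_, mem_lelongSlopes_of_lt_lelongNumber (le_max_left _ _) hlt',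
        lt_of_lt_of_le (by linarith) (le_max_right _ _)⟩
  obtain ⟨γ, hγm, hγlt⟩ := hγ
  obtain ⟨γ', hγ'm, hγ'lt⟩ := hγ'
  have hsum : γ + γ' ≤ lelongNumber (u + v) a := by
    rw [lelongNumber_eq_sSup]
    exact le_csSup hbdd (add_mem_lelongSlopes hγm hγ'm)
  rw [hε] at hγlt hγ'lt
  linarith

end Literature.Analysis.Pluripotential

end
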